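import Summits.QuantumFields.BalabanUV.T4Continuum.Support.NE7SpectralResolution
import HarnessLib

/-!
# NE7SingleGenerator — A SINGLE SELF-ADJOINT GENERATOR FOR A COMMUTING FAMILY OF SELF-ADJOINT MATRICES: reals `t_s` such that every `x_s` acts as a SCALAR on every
# spectral projection of `Σ t_s x_s` (file S3b-2b of the `k`-uniform stabiliser lifting programme: the algebra behind (ACU))

Cell `pub-balaban`, rung (B)+1 sub-cell t4, lineage `b2b-balaban-t4-ne7b-p1` (row NE7b OWNER + CRUX PROVER; junction service for row NE7, ruling R-OWNER-149-1 (2)),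
generation 159.  Memo `t4/b2b-balaban-t4-ne7b-p1/g159/records/S3-BRIEF.md` §2 (b).  Over ✓ `NE7SpectralResolution`.
THE ARGUMENT.  Two at a time: for commuting self-adjoint `x, y` and `t` with `μ + tν` injective on `σ(x) × σ(y)` (such `t` exist: avoid the finitely many ratios
`(μ′ − μ)∕(ν − ν′)`, `ℝ` is infinite), the joint resolution `P(μ,ν) = E_μ(x) E_ν(y)` carries `x + ty = Σ (μ + tν) P(μ,ν)`, so (✓ `cfc_eq_sum_of_resolution`) each spectral
projection of `x + ty` is a single `P(μ,ν)` or `0`, on which everything that is a scalar on the `E_μ(x)` (resp. `E_ν(y)`) and commutes with `y` (resp. `x`) is a scalar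
(**`scalar_on_specProj_add`**); induction on the family (**`exists_separating_combination`**).
WHAT ([folklore]; 0 def, 0 sorry).  HONEST FRAMING (page 1): elementary finite-dimensional spectral theory; nothing of Bałaban's; NOT (ACU), NOT NE7, NOT NE3; row NE7b NOT
PRINTED ∕ NOT PROVED; spine 0∕9; finite T⁴ rung (B)+1 — NOT infinite volume, NOT mass gap, NOT BetaPertH, NOT Clay.
-/

set_option autoImplicit false

open scoped Matrix.Norms.L2Operator BigOperators
open Finset Polynomial

namespace Summit.QuantumFields.BalabanUV.T4Continuum.NE7SingleGenerator

open NE7SpectralResolution (specProj_mul_specProj sum_specProj eq_sum_smul_specProj commute_specProj cfc_eq_sum_of_resolution)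

noncomputable section

variable {n : Type} [Fintype n] [DecidableEq n]

/-! ## §3 A single self-adjoint generator for a commuting family -/

/-- **TWO COMMUTING SELF-ADJOINTS GENERATE THROUGH `x + t y` FOR A SEPARATING `t`**: if `μ + tν` is injective on `σ(x) × σ(y)`, then every `z` commuting with `y` and acting as
a scalar on each spectral projection of `x` (resp. commuting with `x` and scalar on those of `y`) acts as a scalar on each spectral projection of `x + t y`. [folklore] -/
theorem scalar_on_specProj_add [Nonempty n] {x y : Matrix n n ℂ} (hx : IsSelfAdjoint x) (hy : IsSelfAdjoint y) (hxy : Commute x y) {t : ℝ}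
    (hinj : ∀ μ ∈ spectrum ℝ x, ∀ μ' ∈ spectrum ℝ x, ∀ ν ∈ spectrum ℝ y, ∀ ν' ∈ spectrum ℝ y, μ + t * ν = μ' + t * ν' → μ = μ' ∧ ν = ν')
    (k : ℝ) :
    (∀ z : Matrix n n ℂ, Commute z y → (∀ μ : ℝ, ∃ c : ℂ, z * cfc (fun s : ℝ => if s = μ then (1 : ℝ) else 0) x = c • cfc (fun s : ℝ => if s = μ then (1 : ℝ) else 0) x) →
        ∃ c : ℂ, z * cfc (fun s : ℝ => if s = k then (1 : ℝ) else 0) (x + (t : ℂ) • y) = c • cfc (fun s : ℝ => if s = k then (1 : ℝ) else 0) (x + (t : ℂ) • y)) ∧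
    (∀ z : Matrix n n ℂ, Commute z x → (∀ ν : ℝ, ∃ c : ℂ, z * cfc (fun s : ℝ => if s = ν then (1 : ℝ) else 0) y = c • cfc (fun s : ℝ => if s = ν then (1 : ℝ) else 0) y) →
        ∃ c : ℂ, z * cfc (fun s : ℝ => if s = k then (1 : ℝ) else 0) (x + (t : ℂ) • y) = c • cfc (fun s : ℝ => if s = k then (1 : ℝ) else 0) (x + (t : ℂ) • y)) := by
  classical
  set Sx : Finset ℝ := (Matrix.finite_real_spectrum (A := x)).toFinset with hSx
  set Sy : Finset ℝ := (Matrix.finite_real_spectrum (A := y)).toFinset with hSy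
  have hSxmem : ∀ μ, μ ∈ Sx ↔ μ ∈ spectrum ℝ x := fun μ => by rw [hSx, Set.Finite.mem_toFinset]
  have hSymem : ∀ ν, ν ∈ Sy ↔ ν ∈ spectrum ℝ y := fun ν => by rw [hSy, Set.Finite.mem_toFinset]
  set Ex : ℝ → Matrix n n ℂ := fun μ => cfc (fun s : ℝ => if s = μ then (1 : ℝ) else 0) x with hEx
  set Ey : ℝ → Matrix n n ℂ := fun ν => cfc (fun s : ℝ => if s = ν then (1 : ℝ) else 0) y with hEy
  -- the joint resolution `P (μ, ν) = E_μ(x) E_ν(y)` over `Sx × Sy`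
  set P : ↥Sx × ↥Sy → Matrix n n ℂ := fun p => Ex p.1 * Ey p.2 with hP
  have hcommE : ∀ μ ν, Commute (Ex μ) (Ey ν) := fun μ ν =>
    ((commute_specProj (commute_specProj hxy.symm μ).symm ν) : Commute (Ex μ) (Ey ν))
  have horth : ∀ p q : ↥Sx × ↥Sy, P p * P q = if p = q then P p else 0 := by
    rintro ⟨μ, ν⟩ ⟨μ', ν'⟩
    simp only [hP]
    calc Ex μ * Ey ν * (Ex μ' * Ey ν') = Ex μ * (Ey ν * Ex μ') * Ey ν' := by noncomm_ring
      _ = Ex μ * (Ex μ' * Ey ν) * Ey ν' := by rw [(hcommE μ' ν).eq]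
      _ = (Ex μ * Ex μ') * (Ey ν * Ey ν') := by noncomm_ring
      _ = (if (μ : ℝ) = μ' then Ex μ else 0) * (if (ν : ℝ) = ν' then Ey ν else 0) := by
          rw [show Ex μ * Ex μ' = if (μ : ℝ) = μ' then Ex μ else 0 from specProj_mul_specProj x μ μ',
            show Ey ν * Ey ν' = if (ν : ℝ) = ν' then Ey ν else 0 from specProj_mul_specProj y ν ν']
      _ = if (⟨μ, ν⟩ : ↥Sx × ↥Sy) = ⟨μ', ν'⟩ then Ex μ * Ey ν else 0 := by
          by_cases h1 : (μ : ℝ) = μ'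
          · by_cases h2 : (ν : ℝ) = ν'
            · have : μ = μ' := Subtype.ext h1
              have : ν = ν' := Subtype.ext h2
              subst_vars; simp
            · have hne : (⟨μ, ν⟩ : ↥Sx × ↥Sy) ≠ ⟨μ', ν'⟩ := fun h => h2 (congrArg (fun p : ↥Sx × ↥Sy => (p.2 : ℝ)) h)
              simp [h2, hne]
          · have hne : (⟨μ, ν⟩ : ↥Sx × ↥Sy) ≠ ⟨μ', ν'⟩ := fun h => h1 (congrArg (fun p : ↥Sx × ↥Sy => (p.1 : ℝ)) h)
            simp [h1, hne]
  have hsumx : ∑ μ : ↥Sx, Ex μ = 1 := by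
    have h := sum_specProj x hx
    rw [← Finset.sum_coe_sort] at h
    exact h
  have hsumy : ∑ ν : ↥Sy, Ey ν = 1 := by
    have h := sum_specProj y hy
    rw [← Finset.sum_coe_sort] at h
    exact h
  have hsum : ∑ p : ↥Sx × ↥Sy, P p = 1 := by
    rw [Fintype.sum_prod_type]
    simp only [hP]
    rw [← Finset.sum_mul_sum, hsumx, hsumy, one_mul]
  -- `x + t y = Σ (μ + tν) P`
  have hxsum : x = ∑ μ : ↥Sx, ((μ : ℝ) : ℂ) • Ex μ := by
    have h := eq_sum_smul_specProj x hx
    rw [← Finset.sum_coe_sort] at h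
    exact h
  have hysum : y = ∑ ν : ↥Sy, ((ν : ℝ) : ℂ) • Ey ν := by
    have h := eq_sum_smul_specProj y hy
    rw [← Finset.sum_coe_sort] at h
    exact h
  have hres : x + (t : ℂ) • y = ∑ p : ↥Sx × ↥Sy, (((p.1 : ℝ) + t * (p.2 : ℝ) : ℝ) : ℂ) • P p := by
    have hx' : x = ∑ p : ↥Sx × ↥Sy, (((p.1 : ℝ)) : ℂ) • P p := by
      calc x = ∑ μ : ↥Sx, ((μ : ℝ) : ℂ) • Ex μ := hxsum
        _ = ∑ μ : ↥Sx, ((μ : ℝ) : ℂ) • (Ex μ * ∑ ν : ↥Sy, Ey ν) := by rw [hsumy]; simp only [mul_one]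
        _ = ∑ μ : ↥Sx, ∑ ν : ↥Sy, ((μ : ℝ) : ℂ) • (Ex μ * Ey ν) := by
            refine Finset.sum_congr rfl fun μ _ => ?_
            rw [Finset.mul_sum, Finset.smul_sum]
        _ = ∑ p : ↥Sx × ↥Sy, (((p.1 : ℝ)) : ℂ) • P p := by rw [Fintype.sum_prod_type]
    have hy' : y = ∑ p : ↥Sx × ↥Sy, (((p.2 : ℝ)) : ℂ) • P p := by
      calc y = (∑ μ : ↥Sx, Ex μ) * y := by rw [hsumx, one_mul]
        _ = ∑ μ : ↥Sx, Ex μ * y := Finset.sum_mul _ _ _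
        _ = ∑ μ : ↥Sx, Ex μ * ∑ ν : ↥Sy, ((ν : ℝ) : ℂ) • Ey ν := by rw [← hysum]
        _ = ∑ μ : ↥Sx, ∑ ν : ↥Sy, ((ν : ℝ) : ℂ) • (Ex μ * Ey ν) := by
            refine Finset.sum_congr rfl fun μ _ => ?_
            rw [Finset.mul_sum]
            refine Finset.sum_congr rfl fun ν _ => ?_
            rw [mul_smul_comm]
        _ = ∑ p : ↥Sx × ↥Sy, (((p.2 : ℝ)) : ℂ) • P p := by rw [Fintype.sum_prod_type]
    conv_lhs => rw [hx', hy']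
    rw [Finset.smul_sum, ← Finset.sum_add_distrib]
    refine Finset.sum_congr rfl fun p _ => ?_
    rw [smul_smul, ← add_smul]
    congr 1
    push_cast; ring
  have ht : IsSelfAdjoint (t : ℂ) := by
    rw [IsSelfAdjoint, Complex.star_def, Complex.conj_ofReal]
  have hsa' : IsSelfAdjoint (x + (t : ℂ) • y) := hx.add (ht.smul hy)
  have hsa : IsSelfAdjoint (∑ p : ↥Sx × ↥Sy, (((p.1 : ℝ) + t * (p.2 : ℝ) : ℝ) : ℂ) • P p) := by rw [← hres]; exact hsa'
  -- the spectral projection of `x + t y` at `k` through the joint resolution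
  have hE : cfc (fun s : ℝ => if s = k then (1 : ℝ) else 0) (x + (t : ℂ) • y)
      = ∑ p : ↥Sx × ↥Sy, (((if (p.1 : ℝ) + t * (p.2 : ℝ) = k then (1 : ℝ) else 0 : ℝ)) : ℂ) • P p := by
    rw [hres]
    exact cfc_eq_sum_of_resolution P (fun p : ↥Sx × ↥Sy => (p.1 : ℝ) + t * (p.2 : ℝ)) horth hsum hsa _
  -- injectivity: all pairs on the level set `μ + tν = k` share `μ` and `ν`
  have huniq : ∀ p q : ↥Sx × ↥Sy, (p.1 : ℝ) + t * (p.2 : ℝ) = k → (q.1 : ℝ) + t * (q.2 : ℝ) = k → p = q := by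
    intro p q hp hq
    have h := hinj p.1 ((hSxmem _).mp p.1.2) q.1 ((hSxmem _).mp q.1.2) p.2 ((hSymem _).mp p.2.2) q.2 ((hSymem _).mp q.2.2) (by rw [hp, hq])
    exact Prod.ext (Subtype.ext h.1) (Subtype.ext h.2)
  -- a generic collapse: if `z P_p = c_p P_p` then `z E = c₀ E`
  have hcollapse : ∀ (z : Matrix n n ℂ) (c : ↥Sx × ↥Sy → ℂ), (∀ p, z * P p = c p • P p) →
      ∃ c₀ : ℂ, z * cfc (fun s : ℝ => if s = k then (1 : ℝ) else 0) (x + (t : ℂ) • y) = c₀ • cfc (fun s : ℝ => if s = k then (1 : ℝ) else 0) (x + (t : ℂ) • y) := by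
    intro z c hz
    by_cases hex : ∃ p₀ : ↥Sx × ↥Sy, (p₀.1 : ℝ) + t * (p₀.2 : ℝ) = k
    · obtain ⟨p₀, hp₀⟩ := hex
      refine ⟨c p₀, ?_⟩
      rw [hE, Finset.mul_sum, Finset.smul_sum]
      refine Finset.sum_congr rfl fun p _ => ?_
      by_cases hp : (p.1 : ℝ) + t * (p.2 : ℝ) = k
      · rw [huniq p p₀ hp hp₀, mul_smul_comm, hz p₀, smul_smul, smul_smul, mul_comm]
      · simp [hp]
    · refine ⟨0, ?_⟩
      rw [hE, zero_smul, Finset.mul_sum]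
      refine Finset.sum_eq_zero fun p _ => ?_
      have hp : ¬ ((p.1 : ℝ) + t * (p.2 : ℝ) = k) := fun h => hex ⟨p, h⟩
      simp [hp]
  refine ⟨fun z hzy hz => ?_, fun z hzx hz => ?_⟩
  · choose c hc using hz
    refine hcollapse z (fun p => c p.1) fun p => ?_
    show z * (Ex p.1 * Ey p.2) = c p.1 • (Ex p.1 * Ey p.2)
    rw [← mul_assoc, show z * Ex p.1 = c p.1 • Ex p.1 from hc p.1, smul_mul_assoc]
  · choose c hc using hz
    refine hcollapse z (fun p => c p.2) fun p => ?_
    show z * (Ex p.1 * Ey p.2) = c p.2 • (Ex p.1 * Ey p.2)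
    have hzE : Commute z (Ex p.1) := commute_specProj hzx p.1
    rw [← mul_assoc, hzE.eq, mul_assoc, show z * Ey p.2 = c p.2 • Ey p.2 from hc p.2, mul_smul_comm]

/-- **A SINGLE SELF-ADJOINT GENERATOR FOR A COMMUTING SELF-ADJOINT FAMILY**: for pairwise commuting self-adjoint matrices `x_s` (`s : Fin m`) there are reals `t_s` such that
every `x_s` acts as a scalar on every spectral projection of `h = Σ_s t_s x_s`. [folklore] -/
theorem exists_separating_combination [Nonempty n] :
    ∀ (m : ℕ) (x : Fin m → Matrix n n ℂ), (∀ s, IsSelfAdjoint (x s)) → (∀ s s', Commute (x s) (x s')) →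
      ∃ t : Fin m → ℝ, ∀ (s : Fin m) (k : ℝ), ∃ c : ℂ,
        x s * cfc (fun u : ℝ => if u = k then (1 : ℝ) else 0) (∑ s', ((t s' : ℝ) : ℂ) • x s')
          = c • cfc (fun u : ℝ => if u = k then (1 : ℝ) else 0) (∑ s', ((t s' : ℝ) : ℂ) • x s') := by
  intro m
  induction m with
  | zero => intro x _ _; exact ⟨Fin.elim0, fun s => Fin.elim0 s⟩
  | succ m ih =>
      intro x hsa hcomm
      classical
      obtain ⟨t, ht⟩ := ih (fun s => x (Fin.castSucc s)) (fun s => hsa _) (fun s s' => hcomm _ _)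
      set h : Matrix n n ℂ := ∑ s' : Fin m, ((t s' : ℝ) : ℂ) • x (Fin.castSucc s') with hh
      set y : Matrix n n ℂ := x (Fin.last m) with hy
      have hreal : ∀ r : ℝ, IsSelfAdjoint (r : ℂ) := fun r => by rw [IsSelfAdjoint, Complex.star_def, Complex.conj_ofReal]
      have hhsa : IsSelfAdjoint h := by
        rw [IsSelfAdjoint, hh, star_sum]
        refine Finset.sum_congr rfl fun s' _ => ?_
        rw [star_smul, (hreal _).star_eq, (hsa _).star_eq]
      have hysa : IsSelfAdjoint y := hsa _
      have hhy : Commute h y := by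
        rw [hh]
        exact Commute.sum_left _ _ _ fun s' _ => (hcomm _ _).smul_left _
      -- a separating `t₀`: avoid the finitely many ratios `(μ′ − μ)/(ν − ν′)`
      set Sh : Finset ℝ := (Matrix.finite_real_spectrum (A := h)).toFinset with hSh
      set Sy : Finset ℝ := (Matrix.finite_real_spectrum (A := y)).toFinset with hSy
      set B : Finset ℝ := ((Sh ×ˢ Sh) ×ˢ (Sy ×ˢ Sy)).image (fun q => (q.1.2 - q.1.1) / (q.2.1 - q.2.2)) with hB
      obtain ⟨t₀, ht₀⟩ := Infinite.exists_notMem_finset B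
      have hinj : ∀ μ ∈ spectrum ℝ h, ∀ μ' ∈ spectrum ℝ h, ∀ ν ∈ spectrum ℝ y, ∀ ν' ∈ spectrum ℝ y,
          μ + t₀ * ν = μ' + t₀ * ν' → μ = μ' ∧ ν = ν' := by
        intro μ hμ μ' hμ' ν hν ν' hν' heq
        by_cases hνν : ν = ν'
        · subst hνν
          exact ⟨by linarith, rfl⟩
        · exfalso
          apply ht₀
          rw [hB, Finset.mem_image]
          refine ⟨((μ, μ'), (ν, ν')), ?_, ?_⟩
          · simp only [Finset.mem_product, hSh, hSy, Set.Finite.mem_toFinset]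
            exact ⟨⟨hμ, hμ'⟩, hν, hν'⟩
          · have hne : ν - ν' ≠ 0 := sub_ne_zero.mpr hνν
            field_simp
            linarith
      have two := scalar_on_specProj_add hhsa hysa hhy hinj
      -- the new coefficients
      refine ⟨Fin.snoc t t₀, fun s k => ?_⟩
      have hsum_snoc : ∑ s' : Fin (m + 1), (((Fin.snoc t t₀ : Fin (m + 1) → ℝ) s' : ℝ) : ℂ) • x s' = h + (t₀ : ℂ) • y := by
        rw [Fin.sum_univ_castSucc]
        simp only [Fin.snoc_castSucc, Fin.snoc_last, hh, hy]
      rw [hsum_snoc]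
      refine Fin.lastCases ?_ (fun s => ?_) s
      · -- the new operator `y`: commutes with `h`, scalar on its own spectral projections
        refine (two k).2 y hhy.symm fun ν => ⟨(ν : ℂ), ?_⟩
        have h1 := eq_sum_smul_specProj y hysa
        -- `y E_ν(y) = ν E_ν(y)`
        calc y * cfc (fun u : ℝ => if u = ν then (1 : ℝ) else 0) y
            = (∑ k' ∈ Sy, ((k' : ℝ) : ℂ) • cfc (fun u : ℝ => if u = k' then (1 : ℝ) else 0) y) * cfc (fun u : ℝ => if u = ν then (1 : ℝ) else 0) y := by
              rw [← h1]
          _ = ∑ k' ∈ Sy, ((k' : ℝ) : ℂ) • (cfc (fun u : ℝ => if u = k' then (1 : ℝ) else 0) y * cfc (fun u : ℝ => if u = ν then (1 : ℝ) else 0) y) := by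
              rw [Finset.sum_mul]; refine Finset.sum_congr rfl fun k' _ => smul_mul_assoc _ _ _
          _ = ∑ k' ∈ Sy, if k' = ν then ((ν : ℝ) : ℂ) • cfc (fun u : ℝ => if u = ν then (1 : ℝ) else 0) y else 0 := by
              refine Finset.sum_congr rfl fun k' _ => ?_
              rw [specProj_mul_specProj]
              split_ifs with hk'
              · subst hk'; rfl
              · rw [smul_zero]
          _ = ((ν : ℝ) : ℂ) • cfc (fun u : ℝ => if u = ν then (1 : ℝ) else 0) y := by
              rw [Finset.sum_ite_eq']
              split_ifs with hν
              · rfl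
              · -- `ν ∉ σ(y)`: the projection vanishes... no: it is `cfc` of a function vanishing on the spectrum
                have hz : cfc (fun u : ℝ => if u = ν then (1 : ℝ) else 0) y = 0 := by
                  have hcongr : (spectrum ℝ y).EqOn (fun u : ℝ => if u = ν then (1 : ℝ) else 0) 0 := by
                    intro u hu
                    have hne : u ≠ ν := fun h => hν (by rw [hSy, Set.Finite.mem_toFinset, ← h]; exact hu)
                    simp [hne]
                  rw [cfc_congr hcongr, cfc_zero]
                rw [hz, smul_zero]
      · -- an old operator: commutes with `y`, scalar on the spectral projections of `h` (induction hypothesis)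
        exact (two k).1 (x (Fin.castSucc s)) (hcomm _ _) fun μ => ht s μ


end

end Summit.QuantumFields.BalabanUV.T4Continuum.NE7SingleGenerator
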